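import Mathlib.Tactic.Linarith
import Mathlib.Tactic.Positivity
import Mathlib.Tactic.Ring
import Mathlib.Data.Real.Basic
import HarnessLib

/-!
# Cutoff core (R-D1 / R-P2c(ii)) — the scalar inequality behind every wavenumber cutoff of the pub-turb Rayleigh–Bénard certificates
(cell `pub-turb` / `turb-bounds`; files of record HOME/pub-turb-sos/FORMULATION-SPEC.md §D (D1), HOME/PARAM.md §8 (R-P2c), HOME/pub-turb-sos/P2-PROOF.md §2.6;
LEAN-MAP.md §2 step 6. Written by pub-turb-sos, planner-pub-turb-sos-g4-0.)

HONEST FRAMING: rigorous bounds for the stated PDE and boundary conditions; no claim about physical turbulence beyond the bound.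
This file contains NO fluid mechanics. After the positive terms of the spectral-constraint quadratic form at wavenumber data `K`
are dropped, what remains to be shown for every LARGE `K` is a real 2-variable quadratic inequality
`2·T·x·y ≤ α·x² + β·y²` (x, y = the two field norms; α, β ≥ 0 the K-dependent diagonal weights; T ≥ |coupling|).
`quad_core`: it holds for all real x, y as soon as `T² ≤ α·β` (discriminant ≤ 0).  `p2_cutoff`: the P2 instance
α = (s-1)·K, β = s·K — if `T² ≤ (s-1)·s·K_c²` (the certificate's CUTOFF line, checked exactly in `Certs/<Row>/Scalars.lean`)
then the inequality holds for EVERY `K ≥ K_c` (monotone in K), i.e. all wavenumbers beyond the cutoff are free and only the compact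
range `(0, K_c]` needs LMI blocks.  `rb_cutoff`: the same with a general product form `T² ≤ c·K_c²`, `α·β = c·K²`.
-/

namespace Summit.NavierStokesRegularity.TurbBounds

/-- Discriminant form of the 2 × 2 PSD test: if `0 ≤ α`, `0 ≤ β` and `T² ≤ α·β` then `2·T·x·y ≤ α·x² + β·y²` for all real `x, y`. -/
theorem quad_core {α β T : ℝ} (hα : 0 ≤ α) (hβ : 0 ≤ β) (hT : T ^ 2 ≤ α * β) (x y : ℝ) :
    2 * T * x * y ≤ α * x ^ 2 + β * y ^ 2 := by
  rcases hα.eq_or_lt with h0 | hpos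
  · -- α = 0 forces T = 0
    have hT0 : T ^ 2 ≤ 0 := by simpa [← h0] using hT
    have hT' : T = 0 := by nlinarith [sq_nonneg T]
    subst hT'
    have : 0 ≤ β * y ^ 2 := mul_nonneg hβ (sq_nonneg y)
    nlinarith [mul_nonneg hα (sq_nonneg x)]
  · -- α > 0: α·(α x² + β y² − 2 T x y) = (α x − T y)² + (α β − T²) y² ≥ 0
    have key : α * (α * x ^ 2 + β * y ^ 2 - 2 * T * x * y) = (α * x - T * y) ^ 2 + (α * β - T ^ 2) * y ^ 2 := by ring
    have hnn : 0 ≤ α * (α * x ^ 2 + β * y ^ 2 - 2 * T * x * y) := by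
      rw [key]; nlinarith [sq_nonneg (α * x - T * y), mul_nonneg (sub_nonneg.mpr hT) (sq_nonneg y)]
    have := (mul_nonneg_iff_of_pos_left hpos).mp hnn
    linarith

/-- General cutoff: if `T² ≤ c·K_c²` with `0 ≤ c`, `0 ≤ K_c`, then for every `K ≥ K_c` and all nonnegative weights with
`α·β = c·K²` the inequality `2·T·x·y ≤ α·x² + β·y²` holds for all real `x, y`. -/
theorem rb_cutoff {c Kc T : ℝ} (hc : 0 ≤ c) (hKc : 0 ≤ Kc) (hT : T ^ 2 ≤ c * Kc ^ 2)
    {K α β : ℝ} (hK : Kc ≤ K) (hα : 0 ≤ α) (hβ : 0 ≤ β) (hαβ : α * β = c * K ^ 2) (x y : ℝ) :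
    2 * T * x * y ≤ α * x ^ 2 + β * y ^ 2 := by
  apply quad_core hα hβ
  have hK0 : 0 ≤ K := le_trans hKc hK
  have : Kc ^ 2 ≤ K ^ 2 := by nlinarith
  calc T ^ 2 ≤ c * Kc ^ 2 := hT
    _ ≤ c * K ^ 2 := by exact mul_le_mul_of_nonneg_left this hc
    _ = α * β := hαβ.symm

/-- P2 cutoff (R-P2c(ii), Ra-free layer form; P2-PROOF §2.6): with `1 ≤ s`, `0 ≤ K_c` and the certificate line
`T² ≤ (s-1)·s·K_c²`, for every `K ≥ K_c`: `2·T·x·y ≤ (s-1)·K·x² + s·K·y²` for all real `x, y`. -/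
theorem p2_cutoff {s Kc T : ℝ} (hs : 1 ≤ s) (hKc : 0 ≤ Kc) (hT : T ^ 2 ≤ (s - 1) * s * Kc ^ 2)
    {K : ℝ} (hK : Kc ≤ K) (x y : ℝ) :
    2 * T * x * y ≤ (s - 1) * K * x ^ 2 + s * K * y ^ 2 := by
  have hK0 : 0 ≤ K := le_trans hKc hK
  have hs1 : 0 ≤ s - 1 := sub_nonneg.mpr hs
  have hs0 : 0 ≤ s := le_trans zero_le_one hs
  exact rb_cutoff (mul_nonneg hs1 hs0) hKc hT hK (mul_nonneg hs1 hK0) (mul_nonneg hs0 hK0) (by ring) x y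

/-- The sign-free form actually used: with `|g| ≤ T` the coupling term `2·g·x·y` is bounded by the diagonal for every sign of g, x, y. -/
theorem p2_cutoff_abs {s Kc T g : ℝ} (hs : 1 ≤ s) (hKc : 0 ≤ Kc) (hT : T ^ 2 ≤ (s - 1) * s * Kc ^ 2) (hg : |g| ≤ T)
    {K : ℝ} (hK : Kc ≤ K) (x y : ℝ) :
    2 * g * x * y ≤ (s - 1) * K * x ^ 2 + s * K * y ^ 2 := by
  have hT0 : 0 ≤ T := le_trans (abs_nonneg g) hg
  have hg2 : g ^ 2 ≤ (s - 1) * s * Kc ^ 2 := by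
    have : g ^ 2 ≤ T ^ 2 := by
      have := sq_abs g; nlinarith [abs_nonneg g, sq_nonneg (T - |g|), sq_abs g]
    exact le_trans this hT
  exact p2_cutoff hs hKc hg2 hK x y

end Summit.NavierStokesRegularity.TurbBounds
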